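import Summits.CriticalPhenomena.PercolationContinuityZ3.Theorems.PercNearOneGluingNoHeavyQuantClusterLawTV
import Summits.CriticalPhenomena.PercolationContinuityZ3.Theorems.PercNearOneGluingNoHeavyLowerTailCSHTheoremOne
import Literature.Probability.Percolation.ThetaContinuity
import Literature.Probability.Percolation.CriticalContinuityProofs
import HarnessLib

/-!
# QUANT lane (p4 gen 22): the law of the FINITE cluster is TV-right-continuous at EVERY `p` (unconditionally, also at `p_c`),
# TV-continuous off `p_c`, and TV-left-continuous at `p_c` IFF `θ(p_c) = 0` — an equivalent form of the summit statement

builds on p205010 (kernel theorem, internal audit signed; external expert review pending) — used ONLY in the last corollary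
(`finiteLaw_tvContinuousAt`, every `d ≥ 2`, every `p`); §1–§4 and the `iff` of §5 are p205010-free.

Sequel of `…QuantClusterLawTV`.  A "finite-type cluster event" is `B = {C(0) ∈ 𝒜}` with `𝒜` a family of FINITE vertex sets
(equivalently an event of the form `B' ∩ {|C(0)| < ∞}`); their probabilities form the law `L^f_p` of the finite cluster, a
sub-probability of mass `1 − θ(p)`.  The coupling inequality of `…QuantClusterLawCoupling`, restricted to `{|C_p| < ∞}`, has NO
`θ`-defect:

* §1 **`real_cl_ne_inter_finite_le_trunc`** — `P(C_p ≠ C_{p'}, |C_p| < ∞) ≤ P_p(n ≤ |C| < ∞) + 2d·S_n(p)·(p'−p)/(1−p)` (every n);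
* §2 **`abs_sub_le_finite_modulus`** — the same bounds `|P_p(B) − P_{p'}(B)|` for finite-type `B`, `p ≤ p'`;
* §3 **`finiteLaw_tvRightContinuousAt`** — at EVERY `p ∈ [0,1]` (every `d`): `sup_{B finite-type}|P_p(B) − P_{p'}(B)| → 0` as
  `p' ↓ p` (since `P_p(n ≤ |C| < ∞) → 0`); in particular AT `p_c`, unconditionally: the statistics of the finite critical
  cluster are the `p ↓ p_c` limit of the supercritical finite-cluster statistics, uniformly over events — the whole right jump
  `θ(p)` of the cluster law (`…QuantClusterLawOscillation`) is carried by the infinite cluster;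
* §4 **`finiteLaw_tvLeftContinuousAt_of_ne`** — two-sided TV-continuity of `L^f` at every `p ≠ p_c` (`d ≥ 1`; above `p_c`
  by van den Berg–Keane's left-continuity of `θ`);
* §5 **`finiteLaw_tvLeftContinuousAt_criticalProbI_iff`** — `L^f` is TV-left-continuous at `p_c` IFF `θ(p_c) = 0`
  (`PercolationContinuity d`; `d ≥ 2`): AN EQUIVALENT FORM OF THE SUMMIT STATEMENT; hence (p205010) **`finiteLaw_tvContinuousAt`**:
  the law of the finite cluster is TV-continuous at every `p ∈ [0,1]`, every `d ≥ 2`.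

HONEST: elementary on `…QuantClusterLawCoupling/TV`; new as typed; no rate.
-/

noncomputable section

namespace Summit.CriticalPhenomena.PercolationContinuityZ3.Theorems.ClusterLaw

open MeasureTheory Filter Topology Literature.Probability.Percolation Literature.Probability.LatticeModels
open scoped ENNReal Classical

variable {d : ℕ}

/-- `Cℓ[π, U]`: the cluster of the origin in the `π`-open configuration of the labels `U` on `ℤ^d`. -/
local notation3 "Cℓ[" π ", " U "]" => openCluster (configOfLabels π U (zdGraph d)) (0 : Site d)

/-- `cl⁻¹ 𝒜`: the cluster event `{ω | C(0)(ω) ∈ 𝒜}`. -/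
local notation3 "cl⁻¹" 𝒜:arg => (fun ω : BondConfig (Site d) => openCluster ω (0 : Site d)) ⁻¹' 𝒜

/-- `P[p] B`: the `P_p`-probability of `B`. -/
local notation3 "P[" p "]" => fun B : Set (BondConfig (Site d)) => (bondPercolation (zdGraph d) p).real B

/-- `aa p k = P_p(|C(0)| ≥ k)`. -/
local notation3 "aa" => fun (p : unitInterval) (k : ℕ) =>
  (bondPercolation (zdGraph d) p).real (clusterSizeGe (0 : Site d) k)

/-- `SS p n = Σ_{k<n} a_{k+1}(p) = E_p[|C| ∧ n]`. -/
local notation3 "SS" => fun (p : unitInterval) (n : ℕ) =>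
  ∑ k ∈ Finset.range n, (bondPercolation (zdGraph d) p).real (clusterSizeGe (0 : Site d) (k + 1))

/-! ### §1 The coupling inequality on `{|C_p| < ∞}`, truncated at volume `n` -/

/-- `{C_p ≠ C_{p'}} ∩ {|C_p| < ∞} ⊆ {n ≤ |C_p| < ∞} ∪ ⋃_{|S|<n} {C_p = S ≠ C_{p'}}`. -/
theorem setOf_cl_ne_inter_finite_subset_trunc (π π' : ℝ) (n : ℕ) :
    {U : Sym2 (Site d) → ℝ | Cℓ[π, U] ≠ Cℓ[π', U]} ∩ {U | (Cℓ[π, U]).Finite} ⊆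
      {U | configOfLabels π U (zdGraph d) ∈ clusterSizeGe (0 : Site d) n \ percolatesAt (0 : Site d)} ∪
        ⋃ S : Finset (Site d), ({_U | S.card < n} ∩ ({U | Cℓ[π, U] = ↑S} ∩ {U | Cℓ[π', U] ≠ ↑S})) := by
  rintro U ⟨hne, hfin⟩
  rcases setOf_cl_ne_subset π π' n hne with h | h
  · exact Or.inl ⟨h, fun hinf => hinf hfin⟩
  · exact Or.inr h

/-- `P_p(n ≤ |C| < ∞) = a_n(p) − θ(p)`. -/
theorem real_clusterSizeGe_diff_percolatesAt (p : unitInterval) (n : ℕ) :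
    (bondPercolation (zdGraph d) p).real (clusterSizeGe (0 : Site d) n \ percolatesAt (0 : Site d)) =
      aa p n - theta (zdGraph d) 0 p := by
  rw [measureReal_sdiff (percolatesAt_subset_clusterSizeGe (0 : Site d) n) (measurableSet_percolatesAt_holds _)]
  rfl

/-- **The finite-part coupling inequality, truncated** (`ℝ≥0∞`): for `0 ≤ p ≤ p' ≤ 1`, `p < 1`, every `n`,
`P(C_p ≠ C_{p'}, |C_p|<∞) ≤ P_p(n ≤ |C| < ∞) + (p'−p)/(1−p)·Σ_{|S|<n}|∂_E S| P_p(K=S)`. -/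
theorem measure_cl_ne_inter_finite_le_trunc (p p' : unitInterval) (hpp : p ≤ p') (hp1 : (p : ℝ) < 1) (n : ℕ) :
    labelMeasure (Site d) ({U | Cℓ[(p : ℝ), U] ≠ Cℓ[(p' : ℝ), U]} ∩ {U | (Cℓ[(p : ℝ), U]).Finite}) ≤
      bondPercolation (zdGraph d) p (clusterSizeGe (0 : Site d) n \ percolatesAt (0 : Site d)) +
        ENNReal.ofReal (((p' : ℝ) - p) / (1 - p)) *
          ∑' S : Finset (Site d), (if S.card < n then
            ((edgeBoundary (zdGraph d) S).card : ℝ≥0∞) * bondPercolation (zdGraph d) p (clusterIs 0 S) else 0) := by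
  have hA : labelMeasure (Site d)
      {U | configOfLabels (p : ℝ) U (zdGraph d) ∈ clusterSizeGe (0 : Site d) n \ percolatesAt (0 : Site d)} =
      bondPercolation (zdGraph d) p (clusterSizeGe (0 : Site d) n \ percolatesAt (0 : Site d)) :=
    labelMeasure_setOf_config_mem p ((measurableSet_clusterSizeGe 0 n).diff (measurableSet_percolatesAt_holds _))
  calc labelMeasure (Site d) ({U | Cℓ[(p : ℝ), U] ≠ Cℓ[(p' : ℝ), U]} ∩ {U | (Cℓ[(p : ℝ), U]).Finite})
      ≤ labelMeasure (Site d) ({U | configOfLabels (p : ℝ) U (zdGraph d) ∈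
            clusterSizeGe (0 : Site d) n \ percolatesAt (0 : Site d)} ∪
          ⋃ S : Finset (Site d), ({_U | S.card < n} ∩
            ({U | Cℓ[(p : ℝ), U] = ↑S} ∩ {U | Cℓ[(p' : ℝ), U] ≠ ↑S}))) :=
        measure_mono (setOf_cl_ne_inter_finite_subset_trunc _ _ n)
    _ ≤ labelMeasure (Site d) {U | configOfLabels (p : ℝ) U (zdGraph d) ∈
            clusterSizeGe (0 : Site d) n \ percolatesAt (0 : Site d)} +
          labelMeasure (Site d) (⋃ S : Finset (Site d), ({_U | S.card < n} ∩
            ({U | Cℓ[(p : ℝ), U] = ↑S} ∩ {U | Cℓ[(p' : ℝ), U] ≠ ↑S}))) := measure_union_le _ _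
    _ ≤ bondPercolation (zdGraph d) p (clusterSizeGe (0 : Site d) n \ percolatesAt (0 : Site d)) +
          ∑' S : Finset (Site d), labelMeasure (Site d) ({_U | S.card < n} ∩
            ({U | Cℓ[(p : ℝ), U] = ↑S} ∩ {U | Cℓ[(p' : ℝ), U] ≠ ↑S})) := by
        rw [hA]; gcongr; exact measure_iUnion_le _
    _ ≤ bondPercolation (zdGraph d) p (clusterSizeGe (0 : Site d) n \ percolatesAt (0 : Site d)) +
          ∑' S : Finset (Site d), ENNReal.ofReal (((p' : ℝ) - p) / (1 - p)) * (if S.card < n then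
            ((edgeBoundary (zdGraph d) S).card : ℝ≥0∞) * bondPercolation (zdGraph d) p (clusterIs 0 S) else 0) := by
        gcongr with S
        by_cases hS : S.card < n
        · rw [if_pos hS, show ({_U : Sym2 (Site d) → ℝ | S.card < n}) = Set.univ from Set.eq_univ_of_forall fun _ => hS,
            Set.univ_inter]
          exact measure_cl_eq_inter_cl_ne_le p p' hpp hp1 S
        · rw [if_neg hS, show ({_U : Sym2 (Site d) → ℝ | S.card < n}) = ∅ from Set.eq_empty_of_forall_notMem fun _ => hS,
            Set.empty_inter, measure_empty, mul_zero]
    _ = _ := by rw [ENNReal.tsum_mul_left]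

/-- **Real form**: `P(C_p ≠ C_{p'}, |C_p|<∞) ≤ (a_n(p) − θ(p)) + 2d·S_n(p)·(p'−p)/(1−p)`. -/
theorem real_cl_ne_inter_finite_le_trunc (p p' : unitInterval) (hpp : p ≤ p') (hp1 : (p : ℝ) < 1) (n : ℕ) :
    (labelMeasure (Site d)).real ({U | Cℓ[(p : ℝ), U] ≠ Cℓ[(p' : ℝ), U]} ∩ {U | (Cℓ[(p : ℝ), U]).Finite}) ≤
      (aa p n - theta (zdGraph d) 0 p) + 2 * d * SS p n * (((p' : ℝ) - p) / (1 - p)) := by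
  have := isProbabilityMeasure_labelMeasure (Site d)
  have hc : 0 ≤ ((p' : ℝ) - p) / (1 - p) := div_nonneg (sub_nonneg.2 hpp) (by linarith)
  have hSS : 0 ≤ SS p n := Finset.sum_nonneg fun k _ => measureReal_nonneg
  have hdiff : 0 ≤ aa p n - theta (zdGraph d) 0 p := by
    rw [← real_clusterSizeGe_diff_percolatesAt]; exact measureReal_nonneg
  have h := measure_cl_ne_inter_finite_le_trunc (d := d) p p' hpp hp1 n
  have h2 : ∑' S : Finset (Site d), (if S.card < n then
      ((edgeBoundary (zdGraph d) S).card : ℝ≥0∞) * bondPercolation (zdGraph d) p (clusterIs 0 S) else 0) ≤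
      ENNReal.ofReal (2 * d * SS p n) := by
    refine (tsum_perimeter_trunc_le p n).trans ?_
    rw [ENNReal.ofReal_mul (by positivity), show ENNReal.ofReal (2 * (d : ℝ)) = 2 * d by
      rw [ENNReal.ofReal_mul (by norm_num), ENNReal.ofReal_natCast]; simp]
    gcongr
    exact tsum_volume_trunc_le_SS p n
  have h3 : labelMeasure (Site d) ({U | Cℓ[(p : ℝ), U] ≠ Cℓ[(p' : ℝ), U]} ∩ {U | (Cℓ[(p : ℝ), U]).Finite}) ≤
      ENNReal.ofReal ((aa p n - theta (zdGraph d) 0 p) + 2 * d * SS p n * (((p' : ℝ) - p) / (1 - p))) := by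
    refine h.trans ?_
    rw [ENNReal.ofReal_add hdiff (by positivity), ← real_clusterSizeGe_diff_percolatesAt, measureReal_def,
      ENNReal.ofReal_toReal (measure_ne_top _ _), mul_comm (2 * d * SS p n), ENNReal.ofReal_mul hc]
    gcongr
  rw [measureReal_def]
  exact ENNReal.toReal_le_of_le_ofReal (by positivity) h3

/-! ### §2 The TV modulus of the finite-cluster law (no `θ`-defect) -/

/-- **TV MODULUS OF THE FINITE-CLUSTER LAW**: for a family `𝒜` of FINITE vertex sets, `0 ≤ p ≤ p' ≤ 1`, `p < 1`, every `n`: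
`|P_p(C ∈ 𝒜) − P_{p'}(C ∈ 𝒜)| ≤ P_p(n ≤ |C| < ∞) + 2d·E_p[|C|∧n]·(p'−p)/(1−p)`. -/
theorem abs_sub_le_finite_modulus (p p' : unitInterval) (hpp : p ≤ p') (hp1 : (p : ℝ) < 1)
    {𝒜 : Set (Set (Site d))} (h𝒜 : MeasurableSet (cl⁻¹ 𝒜)) (hfin : ∀ S ∈ 𝒜, S.Finite) (n : ℕ) :
    |P[p] (cl⁻¹ 𝒜) - P[p'] (cl⁻¹ 𝒜)| ≤ (aa p n - theta (zdGraph d) 0 p) + 2 * d * SS p n * (((p' : ℝ) - p) / (1 - p)) :=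
  (abs_sub_le_real_cl_ne_finite p p' hpp h𝒜 hfin).trans (real_cl_ne_inter_finite_le_trunc p p' hpp hp1 n)

/-- The same with `S_n ≤ n` and the constants at the LARGER parameter when `p' ≤ p` (`a_n − θ` at `p'`, slope at `p`):
for `p' ≤ p < 1`, `|P_p(B) − P_{p'}(B)| ≤ (a_n(p') − θ(p')) + 2dn(p − p')/(1 − p)`. -/
theorem abs_sub_le_finite_modulus_left (p p' : unitInterval) (hpp : p' ≤ p) (hp1 : (p : ℝ) < 1)
    {𝒜 : Set (Set (Site d))} (h𝒜 : MeasurableSet (cl⁻¹ 𝒜)) (hfin : ∀ S ∈ 𝒜, S.Finite) (n : ℕ) :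
    |P[p] (cl⁻¹ 𝒜) - P[p'] (cl⁻¹ 𝒜)| ≤ (aa p' n - theta (zdGraph d) 0 p') + 2 * d * n * (((p : ℝ) - p') / (1 - p)) := by
  have hp'1 : (p' : ℝ) < 1 := lt_of_le_of_lt (show (p' : ℝ) ≤ p from hpp) hp1
  have h := abs_sub_le_finite_modulus p' p hpp hp'1 h𝒜 hfin n
  rw [abs_sub_comm] at h
  refine h.trans ?_
  have hc : ((p : ℝ) - p') / (1 - p') ≤ ((p : ℝ) - p') / (1 - p) :=
    div_le_div_of_nonneg_left (sub_nonneg.2 hpp) (by linarith) (by linarith [show (p' : ℝ) ≤ p from hpp])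
  have hS := SS_le (d := d) p' n
  have hSS : 0 ≤ SS p' n := Finset.sum_nonneg fun k _ => measureReal_nonneg
  have hc0 : 0 ≤ ((p : ℝ) - p') / (1 - p') := div_nonneg (sub_nonneg.2 hpp) (by linarith)
  nlinarith [mul_le_mul hS hc hc0 (Nat.cast_nonneg n), mul_nonneg hSS hc0]

/-! ### §3 Right-continuity of the finite-cluster law at EVERY `p` -/

/-- `P_p(n ≤ |C| < ∞) → 0` as `n → ∞`, every `p`. -/
theorem tendsto_aa_sub_theta (p : unitInterval) :
    Tendsto (fun n => aa p n - theta (zdGraph d) 0 p) atTop (𝓝 0) := by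
  have h := (tendsto_real_clusterSizeGe (zdGraph d) (0 : Site d) p).sub_const (theta (zdGraph d) 0 p)
  rwa [sub_self] at h

/-- **THE LAW OF THE FINITE CLUSTER IS TV-RIGHT-CONTINUOUS AT EVERY `p ∈ [0,1]`** (every `d`; in particular at `p = p_c`,
unconditionally): for every `ε > 0` there is `δ > 0` such that for all `p' ∈ [p, p+δ)` and ALL finite-type cluster events
`B`, `|P_p(B) − P_{p'}(B)| ≤ ε`. -/
theorem finiteLaw_tvRightContinuousAt (p : unitInterval) {ε : ℝ} (hε : 0 < ε) :
    ∃ δ > 0, ∀ p' : unitInterval, p ≤ p' → (p' : ℝ) - p < δ →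
      ∀ 𝒜 : Set (Set (Site d)), MeasurableSet (cl⁻¹ 𝒜) → (∀ S ∈ 𝒜, S.Finite) →
        |P[p] (cl⁻¹ 𝒜) - P[p'] (cl⁻¹ 𝒜)| ≤ ε := by
  rcases eq_or_lt_of_le (show (p : ℝ) ≤ 1 from p.2.2) with hp1 | hp1
  · -- `p = 1`: only `p' = 1`
    refine ⟨1, one_pos, fun p' hle _ 𝒜 _ _ => ?_⟩
    have : p' = p := le_antisymm (Subtype.coe_le_coe.1 (by rw [hp1]; exact p'.2.2)) hle
    rw [this, sub_self, abs_zero]; exact hε.le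
  · obtain ⟨n, hn⟩ : ∃ n : ℕ, aa p n - theta (zdGraph d) 0 p < ε / 2 :=
      ((tendsto_aa_sub_theta (d := d) p).eventually (eventually_lt_nhds (by linarith))).exists
    set K : ℝ := 2 * d * n / (1 - p) with hK
    have hK0 : 0 ≤ K := by rw [hK]; exact div_nonneg (by positivity) (by linarith)
    refine ⟨ε / (2 * (K + 1)), by positivity, fun p' hle hlt 𝒜 h𝒜 hfin => ?_⟩
    have h := abs_sub_le_finite_modulus p p' hle hp1 h𝒜 hfin n
    have hS := SS_le (d := d) p n
    have hSS : 0 ≤ SS p n := Finset.sum_nonneg fun k _ => measureReal_nonneg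
    have hc0 : 0 ≤ ((p' : ℝ) - p) / (1 - p) := div_nonneg (sub_nonneg.2 hle) (by linarith)
    have h2 : 2 * d * SS p n * (((p' : ℝ) - p) / (1 - p)) ≤ K * ((p' : ℝ) - p) := by
      calc 2 * d * SS p n * (((p' : ℝ) - p) / (1 - p)) ≤ 2 * d * n * (((p' : ℝ) - p) / (1 - p)) := by gcongr
        _ = K * ((p' : ℝ) - p) := by rw [hK]; ring
    have h3 : K * ((p' : ℝ) - p) ≤ ε / 2 := by
      calc K * ((p' : ℝ) - p) ≤ (K + 1) * (ε / (2 * (K + 1))) :=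
            mul_le_mul (by linarith) hlt.le (sub_nonneg.2 hle) (by linarith)
        _ = ε / 2 := by field_simp
    linarith

/-! ### §4 Two-sided continuity off `p_c` -/

/-- **THE LAW OF THE FINITE CLUSTER IS TV-LEFT-CONTINUOUS AT EVERY `p ≠ p_c`** (every `d`): below `p_c` because
`θ ≡ 0` there, above `p_c` by the left-continuity of `θ` (van den Berg–Keane). -/
theorem finiteLaw_tvLeftContinuousAt_of_ne (p : unitInterval) (hp : (p : ℝ) ≠ criticalProb (zdGraph d) 0) {ε : ℝ}
    (hε : 0 < ε) :
    ∃ δ > 0, ∀ p' : unitInterval, p' ≤ p → (p : ℝ) - p' < δ →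
      ∀ 𝒜 : Set (Set (Site d)), MeasurableSet (cl⁻¹ 𝒜) → (∀ S ∈ 𝒜, S.Finite) →
        |P[p] (cl⁻¹ 𝒜) - P[p'] (cl⁻¹ 𝒜)| ≤ ε := by
  rcases eq_or_lt_of_le (show (p : ℝ) ≤ 1 from p.2.2) with hp1 | hp1
  · -- `p = 1` (`p_c < 1`): finite-type `B` has `P_q(B) ≤ 1 − θ(q)`, `θ(1) = 1` (`d ≥ 1`), `θ(p') → θ(1)` (vdB–K); `d = 0` trivial
    have hpc1 : criticalProb (zdGraph d) 0 < (p : ℝ) :=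
      lt_of_le_of_ne (by rw [hp1]; exact (criticalProb_mem_Icc _ _).2) (Ne.symm hp)
    have hcont := theta_continuousWithinAt_Iic_of_criticalProb_lt (d := d) p hpc1
    rw [Metric.continuousWithinAt_iff] at hcont
    obtain ⟨δ₁, hδ₁, hball⟩ := hcont (ε / 3) (by linarith)
    refine ⟨δ₁, hδ₁, fun p' hle hlt 𝒜 h𝒜 hfin => ?_⟩
    have hθ' : dist (theta (zdGraph d) 0 p') (theta (zdGraph d) 0 p) < ε / 3 :=
      hball hle (by rw [Subtype.dist_eq, Real.dist_eq, abs_sub_comm,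
        abs_of_nonneg (by linarith [show (p' : ℝ) ≤ p from hle])]; exact hlt)
    rw [Real.dist_eq, abs_sub_lt_iff] at hθ'
    have hsub : ∀ q : unitInterval, P[q] (cl⁻¹ 𝒜) ≤ 1 - theta (zdGraph d) 0 q := by
      intro q
      have hincl : (cl⁻¹ 𝒜) ⊆ (percolatesAt (0 : Site d) : Set (BondConfig (Site d)))ᶜ :=
        fun ω hω hinf => hinf (hfin _ hω)
      calc P[q] (cl⁻¹ 𝒜) ≤ (bondPercolation (zdGraph d) q).real ((percolatesAt (0 : Site d))ᶜ) :=
            measureReal_mono hincl (measure_ne_top _ _)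
        _ = 1 - theta (zdGraph d) 0 q := probReal_compl_eq_one_sub (measurableSet_percolatesAt_holds _)
    rcases Nat.eq_zero_or_pos d with hd0 | hd0
    · -- `d = 0`: no edges, every `P_q` is the Dirac mass at the empty configuration
      subst hd0
      have hE : (zdGraph 0).edgeSet = ∅ := by
        ext e
        induction e using Sym2.ind with
        | h a b =>
          simp only [SimpleGraph.mem_edgeSet, Set.mem_empty_iff_false, iff_false]
          intro hab
          exact hab.ne (Subsingleton.elim a b)
      have hμ : ∀ q : unitInterval, bondPercolation (zdGraph 0) q = Measure.dirac ∅ := by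
        intro q
        rw [bondPercolation, hE, ProbabilityTheory.setBernoulli_empty]
      simp only [hμ, sub_self, abs_zero]
      exact hε.le
    · have hθ1 : theta (zdGraph d) 0 p = 1 := by
        rw [show p = 1 from Subtype.ext hp1]; exact DCT16.theta_one hd0
      have h1 := hsub p
      have h2 := hsub p'
      have h0 : 0 ≤ P[p] (cl⁻¹ 𝒜) := measureReal_nonneg
      have h0' : 0 ≤ P[p'] (cl⁻¹ 𝒜) := measureReal_nonneg
      rw [abs_sub_le_iff]; constructor <;> linarith
  · by_cases hpc : criticalProb (zdGraph d) 0 < (p : ℝ)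
    · -- above `p_c`
      have hcont := theta_continuousWithinAt_Iic_of_criticalProb_lt (d := d) p hpc
      rw [Metric.continuousWithinAt_iff] at hcont
      obtain ⟨δ₁, hδ₁, hball⟩ := hcont (ε / 3) (by linarith)
      obtain ⟨n, hn⟩ : ∃ n : ℕ, aa p n - theta (zdGraph d) 0 p < ε / 3 :=
        ((tendsto_aa_sub_theta (d := d) p).eventually (eventually_lt_nhds (by linarith))).exists
      set K : ℝ := 2 * d * n / (1 - p) with hK
      have hK0 : 0 ≤ K := by rw [hK]; exact div_nonneg (by positivity) (by linarith)
      refine ⟨min δ₁ (ε / (3 * (K + 1))), lt_min hδ₁ (by positivity), fun p' hle hlt 𝒜 h𝒜 hfin => ?_⟩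
      have hlt1 : (p : ℝ) - p' < δ₁ := lt_of_lt_of_le hlt (min_le_left _ _)
      have hlt2 : (p : ℝ) - p' < ε / (3 * (K + 1)) := lt_of_lt_of_le hlt (min_le_right _ _)
      have hθ' : dist (theta (zdGraph d) 0 p') (theta (zdGraph d) 0 p) < ε / 3 :=
        hball hle (by rw [Subtype.dist_eq, Real.dist_eq, abs_sub_comm,
          abs_of_nonneg (by linarith [show (p' : ℝ) ≤ p from hle])]; exact hlt1)
      rw [Real.dist_eq, abs_sub_lt_iff] at hθ'
      have h := abs_sub_le_finite_modulus_left p p' hle hp1 h𝒜 hfin n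
      have hmono : aa p' n ≤ aa p n :=
        DCT16.real_mono_of_isUpperSet (zdGraph d)
          (fun _ _ hle' hω => le_trans hω (Set.encard_le_encard (openCluster_mono hle' (0 : Site d))))
          (measurableSet_clusterSizeGe 0 n) hle
      have h3 : 2 * d * n * (((p : ℝ) - p') / (1 - p)) ≤ ε / 3 := by
        calc 2 * d * n * (((p : ℝ) - p') / (1 - p)) = K * ((p : ℝ) - p') := by rw [hK]; ring
          _ ≤ (K + 1) * (ε / (3 * (K + 1))) := mul_le_mul (by linarith) hlt2.le (sub_nonneg.2 hle) (by linarith)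
          _ = ε / 3 := by field_simp
      linarith
    · -- below `p_c`: `θ(p') = θ(p) = 0`
      push Not at hpc
      have hplt : (p : ℝ) < criticalProb (zdGraph d) 0 := lt_of_le_of_ne hpc hp
      obtain ⟨n, hn⟩ : ∃ n : ℕ, aa p n - theta (zdGraph d) 0 p < ε / 2 :=
        ((tendsto_aa_sub_theta (d := d) p).eventually (eventually_lt_nhds (by linarith))).exists
      have hθ : theta (zdGraph d) 0 p = 0 := theta_eq_zero_of_lt_criticalProb_holds (zdGraph d) 0 p hplt
      set K : ℝ := 2 * d * n / (1 - p) with hK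
      have hK0 : 0 ≤ K := by rw [hK]; exact div_nonneg (by positivity) (by linarith)
      refine ⟨ε / (2 * (K + 1)), by positivity, fun p' hle hlt 𝒜 h𝒜 hfin => ?_⟩
      have hθ' : theta (zdGraph d) 0 p' = 0 :=
        theta_eq_zero_of_lt_criticalProb_holds (zdGraph d) 0 p' (lt_of_le_of_lt (show (p' : ℝ) ≤ p from hle) hplt)
      have h := abs_sub_le_finite_modulus_left p p' hle hp1 h𝒜 hfin n
      have hmono : aa p' n ≤ aa p n :=
        DCT16.real_mono_of_isUpperSet (zdGraph d)
          (fun _ _ hle' hω => le_trans hω (Set.encard_le_encard (openCluster_mono hle' (0 : Site d))))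
          (measurableSet_clusterSizeGe 0 n) hle
      have h3 : 2 * d * n * (((p : ℝ) - p') / (1 - p)) ≤ ε / 2 := by
        calc 2 * d * n * (((p : ℝ) - p') / (1 - p)) = K * ((p : ℝ) - p') := by rw [hK]; ring
          _ ≤ (K + 1) * (ε / (2 * (K + 1))) := mul_le_mul (by linarith) hlt.le (sub_nonneg.2 hle) (by linarith)
          _ = ε / 2 := by field_simp
      rw [hθ] at hn
      linarith

/-! ### §5 At `p_c`: left-continuity of the finite-cluster law ⟺ `θ(p_c) = 0` -/

/-- **AN EQUIVALENT FORM OF THE SUMMIT STATEMENT** (`d ≥ 2`): the law of the finite cluster is TV-left-continuous at `p_c`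
IF AND ONLY IF `θ(p_c) = 0` (`PercolationContinuity d`).  (⇒: the finite-type event `{|C| < ∞}` has probability `1` below
`p_c`; ⇐: `P_{p'}(n ≤ |C| < ∞) ≤ a_n(p_c) = a_n(p_c) − θ(p_c) → 0`.) -/
theorem finiteLaw_tvLeftContinuousAt_criticalProbI_iff (hd : 2 ≤ d) :
    (∀ ε > 0, ∃ δ > 0, ∀ p' : unitInterval, p' ≤ criticalProbI d → (criticalProbI d : ℝ) - p' < δ →
      ∀ 𝒜 : Set (Set (Site d)), MeasurableSet (cl⁻¹ 𝒜) → (∀ S ∈ 𝒜, S.Finite) →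
        |P[criticalProbI d] (cl⁻¹ 𝒜) - P[p'] (cl⁻¹ 𝒜)| ≤ ε) ↔ PercolationContinuity d := by
  have hpc0 : 0 < (criticalProbI d : ℝ) := by rw [coe_criticalProbI]; exact criticalProb_zd_pos d (by omega)
  have hpc1 : (criticalProbI d : ℝ) < 1 := by rw [coe_criticalProbI]; exact criticalProb_zd_lt_one hd
  constructor
  · intro h
    -- the finite-type event `{|C| < ∞}`
    by_contra hne
    have hθ0 : 0 ≤ theta (zdGraph d) 0 (criticalProbI d) := by unfold theta; exact measureReal_nonneg
    have hpos : 0 < theta (zdGraph d) 0 (criticalProbI d) := lt_of_le_of_ne hθ0 (Ne.symm hne)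
    obtain ⟨δ, hδ, hall⟩ := h (theta (zdGraph d) 0 (criticalProbI d) / 2) (by linarith)
    -- a point `p' < p_c` within `δ`
    set t : ℝ := max ((criticalProbI d : ℝ) - δ / 2) 0 with ht
    have ht0 : 0 ≤ t := le_max_right _ _
    have ht1 : t ≤ 1 := by rw [ht]; exact max_le (by linarith) zero_le_one
    set p' : unitInterval := ⟨t, ht0, ht1⟩
    have hlt : (p' : ℝ) < criticalProbI d := by
      show t < (criticalProbI d : ℝ); rw [ht]; exact max_lt (by linarith) hpc0
    have hdist : (criticalProbI d : ℝ) - p' < δ := by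
      show (criticalProbI d : ℝ) - t < δ; rw [ht]; linarith [le_max_left ((criticalProbI d : ℝ) - δ / 2) 0]
    have hcomp : (cl⁻¹ {S : Set (Site d) | S.Finite}) = (percolatesAt (0 : Site d) : Set (BondConfig (Site d)))ᶜ := by
      ext ω
      simp only [Set.mem_preimage, Set.mem_setOf_eq, Set.mem_compl_iff, percolatesAt, Set.not_infinite]
    have hmeas : MeasurableSet (cl⁻¹ {S : Set (Site d) | S.Finite}) := by
      rw [hcomp]; exact (measurableSet_percolatesAt_holds (0 : Site d)).compl
    have key := hall p' hlt.le hdist {S | S.Finite} hmeas (fun S hS => hS)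
    have e1 : P[criticalProbI d] (cl⁻¹ {S : Set (Site d) | S.Finite}) = 1 - theta (zdGraph d) 0 (criticalProbI d) := by
      show (bondPercolation (zdGraph d) (criticalProbI d)).real (cl⁻¹ {S : Set (Site d) | S.Finite}) = _
      rw [hcomp]; exact probReal_compl_eq_one_sub (measurableSet_percolatesAt_holds _)
    have e2 : P[p'] (cl⁻¹ {S : Set (Site d) | S.Finite}) = 1 - theta (zdGraph d) 0 p' := by
      show (bondPercolation (zdGraph d) p').real (cl⁻¹ {S : Set (Site d) | S.Finite}) = _
      rw [hcomp]; exact probReal_compl_eq_one_sub (measurableSet_percolatesAt_holds _)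
    have hθ' : theta (zdGraph d) 0 p' = 0 :=
      theta_eq_zero_of_lt_criticalProb_holds (zdGraph d) 0 p' (by rw [← coe_criticalProbI]; exact hlt)
    rw [e1, e2, hθ', sub_zero] at key
    rw [abs_le] at key
    linarith [key.1]
  · intro hθ ε hε
    have hθc : theta (zdGraph d) 0 (criticalProbI d) = 0 := hθ
    obtain ⟨n, hn⟩ : ∃ n : ℕ, aa (criticalProbI d) n - theta (zdGraph d) 0 (criticalProbI d) < ε / 2 :=
      ((tendsto_aa_sub_theta (d := d) (criticalProbI d)).eventually (eventually_lt_nhds (by linarith))).exists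
    set K : ℝ := 2 * d * n / (1 - criticalProbI d) with hK
    have hK0 : 0 ≤ K := by rw [hK]; exact div_nonneg (by positivity) (by linarith)
    refine ⟨ε / (2 * (K + 1)), by positivity, fun p' hle hlt 𝒜 h𝒜 hfin => ?_⟩
    have h := abs_sub_le_finite_modulus_left (criticalProbI d) p' hle hpc1 h𝒜 hfin n
    have hmono : aa p' n ≤ aa (criticalProbI d) n :=
      DCT16.real_mono_of_isUpperSet (zdGraph d)
        (fun _ _ hle' hω => le_trans hω (Set.encard_le_encard (openCluster_mono hle' (0 : Site d))))
        (measurableSet_clusterSizeGe 0 n) hle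
    have hθ'0 : 0 ≤ theta (zdGraph d) 0 p' := by unfold theta; exact measureReal_nonneg
    have h3 : 2 * d * n * (((criticalProbI d : ℝ) - p') / (1 - criticalProbI d)) ≤ ε / 2 := by
      calc 2 * d * n * (((criticalProbI d : ℝ) - p') / (1 - criticalProbI d)) = K * ((criticalProbI d : ℝ) - p') := by
            rw [hK]; ring
        _ ≤ (K + 1) * (ε / (2 * (K + 1))) := mul_le_mul (by linarith) hlt.le (sub_nonneg.2 hle) (by linarith)
        _ = ε / 2 := by field_simp
    rw [hθc, sub_zero] at hn
    linarith

/-- **THE LAW OF THE FINITE CLUSTER IS TV-CONTINUOUS AT EVERY `p ∈ [0,1]`, every `d ≥ 2`** (p205010 at `p = p_c`; elsewhere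
unconditional): `∀ ε ∃ δ ∀ |p'−p| < δ ∀ finite-type B: |P_p(B) − P_{p'}(B)| ≤ ε`. -/
theorem finiteLaw_tvContinuousAt (hd : 2 ≤ d) (p : unitInterval) {ε : ℝ} (hε : 0 < ε) :
    ∃ δ > 0, ∀ p' : unitInterval, |(p' : ℝ) - p| < δ →
      ∀ 𝒜 : Set (Set (Site d)), MeasurableSet (cl⁻¹ 𝒜) → (∀ S ∈ 𝒜, S.Finite) →
        |P[p] (cl⁻¹ 𝒜) - P[p'] (cl⁻¹ 𝒜)| ≤ ε := by
  obtain ⟨δ₁, hδ₁, hR⟩ := finiteLaw_tvRightContinuousAt (d := d) p hε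
  have hL : ∃ δ > 0, ∀ p' : unitInterval, p' ≤ p → (p : ℝ) - p' < δ →
      ∀ 𝒜 : Set (Set (Site d)), MeasurableSet (cl⁻¹ 𝒜) → (∀ S ∈ 𝒜, S.Finite) →
        |P[p] (cl⁻¹ 𝒜) - P[p'] (cl⁻¹ 𝒜)| ≤ ε := by
    by_cases hp : (p : ℝ) = criticalProb (zdGraph d) 0
    · have hpc : p = criticalProbI d := Subtype.ext (by rw [hp, coe_criticalProbI])
      rw [hpc]
      exact (finiteLaw_tvLeftContinuousAt_criticalProbI_iff hd).2 (CSH.percolationContinuity_allDimensions d hd) ε hε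
    · exact finiteLaw_tvLeftContinuousAt_of_ne p hp hε
  obtain ⟨δ₂, hδ₂, hL⟩ := hL
  refine ⟨min δ₁ δ₂, lt_min hδ₁ hδ₂, fun p' hp' 𝒜 h𝒜 hfin => ?_⟩
  rcases le_total p p' with hle | hle
  · have h1 : (p' : ℝ) - p < δ₁ := by
      rw [abs_of_nonneg (sub_nonneg.2 (show (p : ℝ) ≤ p' from hle))] at hp'
      exact lt_of_lt_of_le hp' (min_le_left _ _)
    exact hR p' hle h1 𝒜 h𝒜 hfin
  · have h2 : (p : ℝ) - p' < δ₂ := by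
      rw [abs_sub_comm, abs_of_nonneg (sub_nonneg.2 (show (p' : ℝ) ≤ p from hle))] at hp'
      exact lt_of_lt_of_le hp' (min_le_right _ _)
    exact hL p' hle h2 𝒜 h𝒜 hfin

end Summit.CriticalPhenomena.PercolationContinuityZ3.Theorems.ClusterLaw
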